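import Summits.RiemannHypothesis.RiemannHypothesis.Theorems.WeilParityEvenWinsBeyondArchStubSectorContinuity
import Summits.RiemannHypothesis.RiemannHypothesis.Theorems.WeilGroundStateMarkovPartPositiveGroundStateDensity
import Literature.NumberTheory.LFunctions.WeilSemilocalCompactnessProofs
import Summits.RiemannHypothesis.RiemannHypothesis.Theorems.OddSectorOddOneSignedWindowsRenorm
import HarnessLib

/-!
# The set of good windows is closed in `(0, ∞)`
# (helper for crux `OddSector.OddOneSignedWindows`, item stmt-RiemannHypothesis-17778; RH-free)

Call a window `a > 0` GOOD when it carries an odd-sector ground state of Weil's windowed form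
(`IsWeilOddGroundState a u`) that is real and `≥ 0` a.e. on `(0, a)` — the matrix of the crux
`OddOneSignedWindows`, which asks for the set `G` of good windows to be UNBOUNDED
(`(0, ½ log 2] ⊆ G` by `exists_isWeilOddGroundState_oneSigned_of_two_mul_le_log_two`). This file:
**`G` is sequentially closed in `(0, ∞)`** (`goodWindows_seqClosed`, `goodWindow_of_mem_closure`) —
limits of good windows are good, so the first bad window is approached by bad windows from the
right only (2001 Cor. 10.4, "first failure by touchdown").

Proof. Let `uₙ` be one-signed odd ground states at `aₙ → a₀`; pick odd window tests `Gₙ` with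
`‖Gₙ − uₙ‖₂² ≤ 1/(n+1)`, `|Re Q(Gₙ) − ε_od(aₙ)| ≤ 1/(n+1)`. They live on the window `2a₀` with
energies `≤ ε_od(a₀/2) + 1` (antitonicity), so a subsequence converges in `L²` to some `w`
(`ConnesConsaniMoscovici2025_thm_3_6_holds`). Then `Re Q(G_{φ n}) → ε_od(a₀)` by CONTINUITY of
`ε_od` (`stub_sectorContinuity_continuousAt_odd`, route WeilParity); the dilates
`Hₙ = (G_{φ n})_{ηₙ}`, `1 + ηₙ = max(1, a_{φ n}/a₀) → 1`, are odd normalised tests on the window `a₀`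
with `Re Q(Hₙ) − Re Q(G_{φ n}) → 0` (`exists_weilDilate_modulus`) and `Hₙ → w` in `L²` (dilation is
unitary and strongly continuous on tests, `tendsto_integral_norm_sq_weilDilate_sub`), so `w` is an
odd ground state at `a₀`; and `u_{φ n} → w` in `L²` with each `u_{φ n}` real `≥ 0` a.e. on
`(0, a') ⊆ (0, a_{φ n})` for `a' < a₀` eventually, so `w` is one-signed (`ae_sign_of_tendsto_ae`).

References: E. Bombieri, Rend. Mat. Acc. Lincei (9) 11 (2000), §4 Thm 3, Thm 5; A. Connes,
C. Consani, H. Moscovici, arXiv:2511.22755, Thm 3.6; M. Suzuki, arXiv:2606.09096, Thm 1.3.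
-/

noncomputable section

set_option linter.dupNamespace false

open MeasureTheory Set Filter
open scoped Topology

namespace Summit.RiemannHypothesis.RiemannHypothesis.Theorems.OddSector

open Literature.NumberTheory.LFunctions
open Summit.RiemannHypothesis.RiemannHypothesis.Theorems.WeilGroundStateMarkovPart

/-! ### One-signedness passes to `L²` limits (a.e. hypotheses) -/

/-- **One-signedness passes to `L²` limits, a.e. form.** If `fₙ → w` in `L²` and every `fₙ` is
real and `≥ 0` ALMOST EVERYWHERE on `(0, a)`, then so is `w`. [folklore] -/
theorem ae_sign_of_tendsto_ae {f : ℕ → ℝ → ℂ} {w : ℝ → ℂ} {a : ℝ} (hfm : ∀ n, MemLp (f n) 2)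
    (hw : MemLp w 2) (hsign : ∀ n, ∀ᵐ t : ℝ, t ∈ Ioo 0 a → (f n t).im = 0 ∧ 0 ≤ (f n t).re)
    (hlim : Tendsto (fun n ↦ ∫ t, ‖f n t - w t‖ ^ 2) atTop (𝓝 0)) :
    ∀ᵐ t : ℝ, t ∈ Ioo 0 a → (w t).im = 0 ∧ 0 ≤ (w t).re := by
  -- adapted from `ae_sign_of_tendsto` (Theorems/OddSectorOddOneSignedWindowsRenorm.lean)
  set D : ℝ → ℝ := (Ioo 0 a).indicator fun t ↦ (min (w t).re 0) ^ 2 + (w t).im ^ 2 with hD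
  have hDnn : ∀ t, 0 ≤ D t := fun t ↦ by
    simp only [hD]
    exact Set.indicator_nonneg (fun _ _ ↦ by positivity) _
  have hDle : ∀ n, ∀ᵐ t : ℝ, D t ≤ ‖f n t - w t‖ ^ 2 := fun n ↦ by
    filter_upwards [hsign n] with t ht
    simp only [hD, Set.indicator_apply]
    split_ifs with hta
    · exact min_re_sq_add_im_sq_le (ht hta)
    · positivity
  have hsub : ∀ n, Integrable fun t ↦ ‖f n t - w t‖ ^ 2 := fun n ↦
    (memLp_two_iff_integrable_sq_norm ((hfm n).sub hw).1).1 ((hfm n).sub hw)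
  have hI : ∀ n, ∫ t, D t ≤ ∫ t, ‖f n t - w t‖ ^ 2 := fun n ↦
    integral_mono_of_nonneg (Eventually.of_forall hDnn) (hsub n) (hDle n)
  have hI0 : ∫ t, D t = 0 :=
    le_antisymm (ge_of_tendsto' hlim hI) (integral_nonneg hDnn)
  have hDm : AEStronglyMeasurable D volume := by
    have hre : AEMeasurable (fun t ↦ (w t).re) volume :=
      Complex.measurable_re.comp_aemeasurable hw.1.aemeasurable
    have him : AEMeasurable (fun t ↦ (w t).im) volume :=
      Complex.measurable_im.comp_aemeasurable hw.1.aemeasurable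
    exact (((hre.min aemeasurable_const).pow_const 2).add (him.pow_const 2)).indicator
      measurableSet_Ioo |>.aestronglyMeasurable
  have hDint : Integrable D :=
    Integrable.mono' (hsub 0) hDm (by
      filter_upwards [hDle 0] with t ht
      rw [Real.norm_of_nonneg (hDnn t)]; exact ht)
  have hae : D =ᵐ[volume] 0 := (integral_eq_zero_iff_of_nonneg hDnn hDint).1 hI0
  filter_upwards [hae] with t ht hta
  have h0 : (min (w t).re 0) ^ 2 + (w t).im ^ 2 = 0 := by
    simpa [hD, Set.indicator_of_mem hta] using ht
  have h1 : (min (w t).re 0) ^ 2 = 0 := by nlinarith [sq_nonneg (min (w t).re 0), sq_nonneg (w t).im]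
  have h2 : (w t).im ^ 2 = 0 := by nlinarith [sq_nonneg (min (w t).re 0), sq_nonneg (w t).im]
  refine ⟨pow_eq_zero_iff (n := 2) two_ne_zero |>.1 h2, ?_⟩
  have h3 : min (w t).re 0 = 0 := pow_eq_zero_iff (n := 2) two_ne_zero |>.1 h1
  exact min_eq_right_iff.1 h3

/-! ### The dilation group is strongly continuous on test functions -/

/-- **`g_η → g` in `L²` as `η → 0⁺`, for a test function `g`** (`g_η = weilDilate η g`): dominated
convergence — `g` is continuous, and for `0 ≤ η ≤ 1` the dilates are uniformly bounded and
supported in the support of `g`. [folklore] -/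
theorem tendsto_integral_norm_sq_weilDilate_sub {g : ℝ → ℂ} (hg : IsWeilTest g) {η : ℕ → ℝ}
    (hη0 : ∀ n, 0 ≤ η n) (hη1 : ∀ n, η n ≤ 1) (hη : Tendsto η atTop (𝓝 0)) :
    Tendsto (fun n ↦ ∫ t, ‖weilDilate (η n) g t - g t‖ ^ 2) atTop (𝓝 0) := by
  obtain ⟨R, hR⟩ := hg.2.isCompact.isBounded.subset_closedBall 0
  obtain ⟨M, hM⟩ := hg.1.continuous.norm.bddAbove_range_of_hasCompactSupport hg.2.norm
  have hM' : ∀ t, ‖g t‖ ≤ M := fun t ↦ hM ⟨t, rfl⟩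
  have hM0 : 0 ≤ M := (norm_nonneg _).trans (hM' 0)
  have hg0 : ∀ x, R < |x| → g x = 0 := fun x hx ↦
    image_eq_zero_of_notMem_tsupport fun hxs ↦ by
      have := hR hxs
      rw [Metric.mem_closedBall, dist_zero_right, Real.norm_eq_abs] at this
      linarith
  -- pointwise convergence
  have hlim : ∀ t, Tendsto (fun n ↦ ‖weilDilate (η n) g t - g t‖ ^ 2) atTop (𝓝 0) := by
    intro t
    have hs : Tendsto (fun n ↦ (Real.sqrt (1 + η n) : ℂ)) atTop (𝓝 (Real.sqrt (1 + 0) : ℂ)) :=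
      (Complex.continuous_ofReal.tendsto _).comp
        ((Real.continuous_sqrt.tendsto _).comp (tendsto_const_nhds.add hη))
    have ht : Tendsto (fun n ↦ g ((1 + η n) * t)) atTop (𝓝 (g ((1 + 0) * t))) :=
      (hg.1.continuous.tendsto _).comp ((tendsto_const_nhds.add hη).mul tendsto_const_nhds)
    have h1 : Tendsto (fun n ↦ weilDilate (η n) g t) atTop (𝓝 (g t)) := by
      simpa [weilDilate_apply] using hs.mul ht
    simpa using ((by simpa using h1.sub_const (g t) :
      Tendsto (fun n ↦ weilDilate (η n) g t - g t) atTop (𝓝 0)).norm).pow 2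
  -- domination by a constant on `[-R, R]`
  set bound : ℝ → ℝ := (Icc (-R) R).indicator fun _ ↦ (2 * M + M) ^ 2 with hbound
  have hb : ∀ n, ∀ᵐ t : ℝ, ‖‖weilDilate (η n) g t - g t‖ ^ 2‖ ≤ bound t := fun n ↦
    Eventually.of_forall fun t ↦ by
      rw [Real.norm_of_nonneg (by positivity)]
      by_cases ht : t ∈ Icc (-R) R
      · rw [hbound, indicator_of_mem ht]
        have hs : Real.sqrt (1 + η n) ≤ 2 := by
          rw [Real.sqrt_le_left zero_le_two]; linarith [hη1 n]
        have h1 : ‖weilDilate (η n) g t‖ ≤ 2 * M := by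
          rw [weilDilate_apply, norm_mul, Complex.norm_real, Real.norm_of_nonneg (Real.sqrt_nonneg _)]
          exact mul_le_mul hs (hM' _) (norm_nonneg _) zero_le_two
        have h2 : ‖weilDilate (η n) g t - g t‖ ≤ 2 * M + M :=
          (norm_sub_le _ _).trans (add_le_add h1 (hM' t))
        exact pow_le_pow_left₀ (norm_nonneg _) h2 2
      · -- off `[-R, R]` both vanish (`η ≥ 0` only enlarges `|(1+η)t|`)
        have htR : R < |t| := by
          rw [mem_Icc, not_and_or, not_le, not_le] at ht
          rcases ht with h | h
          · linarith [neg_le_abs t]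
          · linarith [le_abs_self t]
        have h2 : g ((1 + η n) * t) = 0 := by
          refine hg0 _ (htR.trans_le ?_)
          rw [abs_mul, abs_of_pos (show (0 : ℝ) < 1 + η n by linarith [hη0 n])]
          nlinarith [hη0 n, abs_nonneg t]
        rw [hbound, indicator_of_notMem ht, weilDilate_apply, hg0 t htR, h2]
        simp
  have hbi : Integrable bound :=
    (integrableOn_const (μ := volume) (s := Icc (-R) R) (C := (2 * M + M) ^ 2)
      (measure_Icc_lt_top).ne).integrable_indicator measurableSet_Icc
  have hmeas : ∀ n, AEStronglyMeasurable (fun t ↦ ‖weilDilate (η n) g t - g t‖ ^ 2) volume :=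
    fun n ↦ by
      have hc : Continuous fun t ↦ weilDilate (η n) g t := by
        simp only [weilDilate_apply]
        exact continuous_const.mul (hg.1.continuous.comp (continuous_const.mul continuous_id))
      exact ((hc.sub hg.1.continuous).norm.pow 2).aestronglyMeasurable
  have := tendsto_integral_of_dominated_convergence bound hmeas hbi hb
    (Eventually.of_forall hlim)
  simpa using this

/-- The dilation is linear: `(f − g)_η = f_η − g_η`. [folklore] -/
theorem weilDilate_sub (η : ℝ) (f g : ℝ → ℂ) :
    weilDilate η (fun t ↦ f t - g t) = fun t ↦ weilDilate η f t - weilDilate η g t := by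
  funext t
  simp only [weilDilate_apply, mul_sub]

/-- A window `b ∈ (0, ∞)` dilated by `1 + η = max(1, b/a₀)` fits into `[-a₀, a₀]`:
`b/(1 + max 0 (b/a₀ − 1)) ≤ a₀`. [folklore] -/
theorem div_one_add_max_le {a₀ b : ℝ} (ha₀ : 0 < a₀) (hb : 0 < b) :
    b / (1 + max 0 (b / a₀ - 1)) ≤ a₀ := by
  rcases le_or_gt b a₀ with h | h
  · rw [max_eq_left (by rw [sub_nonpos, div_le_one ha₀]; exact h), add_zero, div_one]
    exact h
  · rw [max_eq_right (by rw [sub_nonneg, one_le_div ha₀]; exact h.le), add_sub_cancel]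
    exact (by field_simp : b / (b / a₀) = a₀).le

/-! ### Closedness of the good-window set -/

/-- **The set of good windows is sequentially closed in `(0, ∞)`** (registered sub-goal
`goodWindows_seqClosed` of item stmt-RiemannHypothesis-17778). If `aₙ → a₀ > 0` and every window `aₙ`
carries an odd-sector ground state that is real and `≥ 0` a.e. on `(0, aₙ)`, then so does `a₀`
(proof in the module docstring). [folklore] -/
theorem goodWindows_seqClosed :
    ∀ (a₀ : ℝ) (b : ℕ → ℝ), 0 < a₀ → Tendsto b atTop (𝓝 a₀) →
      (∀ n, ∃ u : ℝ → ℂ, IsWeilOddGroundState (b n) u ∧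
        ∀ᵐ t : ℝ, t ∈ Ioo 0 (b n) → (u t).im = 0 ∧ 0 ≤ (u t).re) →
      ∃ u : ℝ → ℂ, IsWeilOddGroundState a₀ u ∧
        ∀ᵐ t : ℝ, t ∈ Ioo 0 a₀ → (u t).im = 0 ∧ 0 ≤ (u t).re := by
  intro a₀ b ha₀ hb hgood
  -- (0) shift the index so that `a₀/2 < b n < 3a₀/2` for all `n`
  obtain ⟨n₀, hn₀⟩ : ∃ n₀, ∀ n ≥ n₀, |b n - a₀| < a₀ / 2 := by
    have := (Metric.tendsto_atTop.1 hb) (a₀ / 2) (half_pos ha₀)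
    simpa [Real.dist_eq] using this
  set b' : ℕ → ℝ := fun n ↦ b (n + n₀) with hb'def
  have hb' : Tendsto b' atTop (𝓝 a₀) := hb.comp (tendsto_add_atTop_nat n₀)
  have hbwin : ∀ n, a₀ / 2 < b' n ∧ b' n < 3 * a₀ / 2 := fun n ↦ by
    have := hn₀ (n + n₀) (Nat.le_add_left _ _)
    rw [abs_lt] at this
    constructor <;> simp only [hb'def] <;> linarith [this.1, this.2]
  have hbpos : ∀ n, 0 < b' n := fun n ↦ by linarith [(hbwin n).1]
  -- (1) one-signed odd ground states and nearby odd window tests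
  choose u hu hsign using fun n ↦ hgood (n + n₀)
  have hG : ∀ n, ∃ G : ℝ → ℂ, (IsWeilTest G ∧ tsupport G ⊆ Icc (-(b' n)) (b' n) ∧
      (∀ t, G (-t) = -G t) ∧ ∫ t, ‖G t‖ ^ 2 = (1 : ℝ)) ∧
      ∫ t, ‖G t - u n t‖ ^ 2 < 1 / ((n : ℝ) + 1) ∧
      |(weilQuadratic G).re - weilOddGroundEnergy (b' n)| < 1 / ((n : ℝ) + 1) := by
    intro n
    obtain ⟨-, g, hg, hQ, hL⟩ := (isWeilOddGroundState_iff_tendsto _ _).1 (hu n)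
    have hpos : (0 : ℝ) < 1 / ((n : ℝ) + 1) := by positivity
    have h1 : ∀ᶠ k in atTop, ∫ t, ‖g k t - u n t‖ ^ 2 < 1 / ((n : ℝ) + 1) :=
      hL.eventually (eventually_lt_nhds hpos)
    have h2 : ∀ᶠ k in atTop, |(weilQuadratic (g k)).re - weilOddGroundEnergy (b' n)| <
        1 / ((n : ℝ) + 1) := by
      have := (Metric.tendsto_nhds.1 hQ) _ hpos
      simpa only [Real.dist_eq] using this
    obtain ⟨k, hk1, hk2⟩ := (h1.and h2).exists
    exact ⟨g k, hg k, hk1, hk2⟩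
  choose G hGt hGu hGQ using hG
  have hGm : ∀ n, MemLp (G n) 2 := fun n ↦ (hGt n).1.memLp_two
  have hum : ∀ n, MemLp (u n) 2 := fun n ↦ (hu n).memLp
  -- all `G n` live on the window `2a₀`, with bounded energies
  have hG2 : ∀ n, IsWeilTest (G n) ∧ tsupport (G n) ⊆ Icc (-(2 * a₀)) (2 * a₀) ∧
      ∫ t, ‖G n t‖ ^ 2 = (1 : ℝ) := fun n ↦
    ⟨(hGt n).1, (hGt n).2.1.trans (Icc_subset_Icc (by linarith [(hbwin n).2])
      (by linarith [(hbwin n).2])), (hGt n).2.2.2⟩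
  set E : ℝ := weilOddGroundEnergy (a₀ / 2) + 1 with hEdef
  have hGE : ∀ n, (weilQuadratic (G n)).re ≤ E := fun n ↦ by
    have h1 : weilOddGroundEnergy (b' n) ≤ weilOddGroundEnergy (a₀ / 2) :=
      weilOddGroundEnergy_antitone (half_pos ha₀) (hbwin n).1.le
    have h2 := (abs_lt.1 (hGQ n)).2
    have h3 : 1 / ((n : ℝ) + 1) ≤ 1 := by
      rw [div_le_one (by positivity)]; linarith [n.cast_nonneg (α := ℝ)]
    linarith
  -- (2) compactness
  obtain ⟨w, hw, φ, hφ, hconv⟩ := ConnesConsaniMoscovici2025_thm_3_6_holds (2 * a₀) (by positivity)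
    G hG2 ⟨E, by rintro _ ⟨n, rfl⟩; exact hGE n⟩
  -- (3) `ε_od(b'(φ n)) → ε_od(a₀)` and `Re Q(G (φ n)) → ε_od(a₀)`
  have hεlim : Tendsto (fun n ↦ weilOddGroundEnergy (b' (φ n))) atTop
      (𝓝 (weilOddGroundEnergy a₀)) :=
    (stub_sectorContinuity_continuousAt_odd ha₀).tendsto.comp (hb'.comp hφ.tendsto_atTop)
  have hinv : Tendsto (fun n ↦ 1 / ((φ n : ℝ) + 1)) atTop (𝓝 0) :=
    tendsto_one_div_add_atTop_nhds_zero_nat.comp hφ.tendsto_atTop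
  have hQG : Tendsto (fun n ↦ (weilQuadratic (G (φ n))).re) atTop (𝓝 (weilOddGroundEnergy a₀)) := by
    have hdiff : Tendsto (fun n ↦ (weilQuadratic (G (φ n))).re - weilOddGroundEnergy (b' (φ n)))
        atTop (𝓝 0) :=
      squeeze_zero_norm (fun n ↦ (Real.norm_eq_abs _).trans_le (hGQ (φ n)).le) hinv
    simpa using hdiff.add hεlim
  -- (4) `u (φ n) → w` in `L²`, hence the sign of `w` on `(0, a₀)`
  have huw : Tendsto (fun n ↦ ∫ t, ‖u (φ n) t - w t‖ ^ 2) atTop (𝓝 0) := by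
    have hbnd : ∀ n, ∫ t, ‖u (φ n) t - w t‖ ^ 2 ≤
        (2 * ∫ t, ‖G (φ n) t - u (φ n) t‖ ^ 2) + 2 * ∫ t, ‖G (φ n) t - w t‖ ^ 2 := by
      intro n
      have h := integral_norm_sq_add_le (((hGm (φ n)).sub (hum (φ n))).neg) ((hGm (φ n)).sub hw)
      have e : (fun x ↦ ‖(-((G (φ n)) - u (φ n))) x + (G (φ n) - w) x‖ ^ 2) =
          fun x ↦ ‖u (φ n) x - w x‖ ^ 2 := by funext x; simp only [Pi.neg_apply, Pi.sub_apply]; ring_nf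
      have e2 : ∫ x, ‖(-((G (φ n)) - u (φ n))) x‖ ^ 2 = ∫ x, ‖G (φ n) x - u (φ n) x‖ ^ 2 :=
        integral_congr_ae (Eventually.of_forall fun x ↦ by
          simp only [Pi.neg_apply, Pi.sub_apply, norm_neg])
      rw [e, e2] at h
      simpa only [Pi.sub_apply] using h
    refine squeeze_zero (fun n ↦ integral_nonneg fun _ ↦ by positivity) hbnd ?_
    have h1 : Tendsto (fun n ↦ ∫ t, ‖G (φ n) t - u (φ n) t‖ ^ 2) atTop (𝓝 0) :=
      squeeze_zero (fun n ↦ integral_nonneg fun _ ↦ by positivity) (fun n ↦ (hGu (φ n)).le) hinv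
    simpa using (h1.const_mul 2).add (hconv.const_mul 2)
  have hwsign : ∀ᵐ t : ℝ, t ∈ Ioo 0 a₀ → (w t).im = 0 ∧ 0 ≤ (w t).re := by
    -- on every `(0, a₀ − 1/(k+1))`, then exhaust
    have hk : ∀ k : ℕ, ∀ᵐ t : ℝ, t ∈ Ioo 0 (a₀ - 1 / ((k : ℝ) + 1)) → (w t).im = 0 ∧ 0 ≤ (w t).re := by
      intro k
      set a' : ℝ := a₀ - 1 / ((k : ℝ) + 1) with ha'
      -- eventually `a' < b' (φ n)`
      obtain ⟨N, hN⟩ : ∃ N, ∀ n ≥ N, a' < b' (φ n) := by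
        have hlt : a' < a₀ := by rw [ha']; linarith [(by positivity : (0 : ℝ) < 1 / ((k : ℝ) + 1))]
        exact eventually_atTop.1 ((hb'.comp hφ.tendsto_atTop).eventually (eventually_gt_nhds hlt))
      have hs : ∀ n, ∀ᵐ t : ℝ, t ∈ Ioo 0 a' → (u (φ (n + N)) t).im = 0 ∧ 0 ≤ (u (φ (n + N)) t).re :=
        fun n ↦ by
          filter_upwards [hsign (φ (n + N))] with t ht hta
          exact ht ⟨hta.1, hta.2.trans (hN _ (Nat.le_add_left _ _))⟩
      exact ae_sign_of_tendsto_ae (fun n ↦ hum (φ (n + N))) hw hs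
        (huw.comp (tendsto_add_atTop_nat N))
    rw [← ae_all_iff] at hk
    filter_upwards [hk] with t ht hta
    obtain ⟨k, hk'⟩ := exists_nat_one_div_lt (by linarith [hta.2] : 0 < a₀ - t)
    exact ht k ⟨hta.1, by linarith⟩
  -- (5) dilate `G (φ n)` onto the window `a₀`
  set η : ℕ → ℝ := fun n ↦ max 0 (b' (φ n) / a₀ - 1) with hηdef
  have hη0 : ∀ n, 0 ≤ η n := fun n ↦ le_max_left _ _
  have hη1 : ∀ n, η n ≤ 1 := fun n ↦ max_le zero_le_one (by
    have := (hbwin (φ n)).2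
    rw [sub_le_iff_le_add, div_le_iff₀ ha₀]; linarith)
  have hηm1 : ∀ n, -1 < η n := fun n ↦ by linarith [hη0 n]
  have hηlim : Tendsto η atTop (𝓝 0) := by
    have h1 : Tendsto (fun n ↦ b' (φ n) / a₀ - 1) atTop (𝓝 (a₀ / a₀ - 1)) :=
      ((hb'.comp hφ.tendsto_atTop).div_const a₀).sub_const 1
    rw [div_self ha₀.ne', sub_self] at h1
    have h2 := (tendsto_const_nhds (x := (0 : ℝ))).max h1
    simpa [hηdef] using h2
  set H : ℕ → ℝ → ℂ := fun n ↦ weilDilate (η n) (G (φ n)) with hHdef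
  have hHt : ∀ n, IsWeilTest (H n) := fun n ↦ (hGt (φ n)).1.weilDilate (hηm1 n)
  have hHs : ∀ n, tsupport (H n) ⊆ Icc (-a₀) a₀ := fun n ↦ by
    have h1 := tsupport_weilDilate_subset (G (φ n)) (hηm1 n) (hGt (φ n)).2.1
    have h2 : b' (φ n) / (1 + η n) ≤ a₀ := div_one_add_max_le ha₀ (hbpos _)
    exact h1.trans (Icc_subset_Icc (by linarith) h2)
  have hHo : ∀ n t, H n (-t) = -H n t := fun n t ↦ by
    have h1 := stub_sectorContinuity_weilDilate_parity (g := G (φ n)) (σ := -1)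
      (fun t ↦ by rw [(hGt (φ n)).2.2.1 t, neg_one_mul]) (η n) t
    rwa [neg_one_mul] at h1
  have hHn : ∀ n, ∫ t, ‖H n t‖ ^ 2 = 1 := fun n ↦ by
    simp only [hHdef]; rw [integral_norm_sq_weilDilate _ (hηm1 n), (hGt (φ n)).2.2.2]
  -- `Re Q(H n) → ε_od(a₀)` (uniform dilation modulus on the window `2a₀`)
  have hQH : Tendsto (fun n ↦ (weilQuadratic (H n)).re) atTop (𝓝 (weilOddGroundEnergy a₀)) := by
    rw [Metric.tendsto_atTop]
    intro ε hε
    obtain ⟨δ, hδ, -, hmod⟩ := exists_weilDilate_modulus (a := 2 * a₀) (by positivity) E (half_pos hε)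
    obtain ⟨N₁, hN₁⟩ := (Metric.tendsto_atTop.1 hQG) (ε / 2) (half_pos hε)
    obtain ⟨N₂, hN₂⟩ : ∃ N₂, ∀ n ≥ N₂, |η n| ≤ δ := by
      obtain ⟨N, hN⟩ := (Metric.tendsto_atTop.1 hηlim) δ hδ
      exact ⟨N, fun n hn ↦ by simpa [Real.dist_eq] using (hN n hn).le⟩
    refine ⟨max N₁ N₂, fun n hn ↦ ?_⟩
    have h1 := hmod (η n) (hN₂ n (le_of_max_le_right hn)) (G (φ n)) (hG2 (φ n)).1 (hG2 (φ n)).2.1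
      (hG2 (φ n)).2.2 (hGE (φ n))
    have h2 := hN₁ n (le_of_max_le_left hn)
    rw [Real.dist_eq] at h2 ⊢
    calc |(weilQuadratic (H n)).re - weilOddGroundEnergy a₀|
        ≤ |(weilQuadratic (H n)).re - (weilQuadratic (G (φ n))).re| +
            |(weilQuadratic (G (φ n))).re - weilOddGroundEnergy a₀| := abs_sub_le _ _ _
      _ < ε / 2 + ε / 2 := add_lt_add_of_le_of_lt h1 h2
      _ = ε := by ring
  -- `H n → w` in `L²`
  have hHL : Tendsto (fun n ↦ ∫ t, ‖H n t - w t‖ ^ 2) atTop (𝓝 0) := by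
    -- the three-epsilon bound through a fixed `G (φ m)`
    have hbnd : ∀ n m, ∫ t, ‖H n t - w t‖ ^ 2 ≤
        (4 * ∫ t, ‖G (φ n) t - w t‖ ^ 2) + (8 * ∫ t, ‖G (φ m) t - w t‖ ^ 2) +
          4 * ∫ t, ‖weilDilate (η n) (G (φ m)) t - G (φ m) t‖ ^ 2 := by
      intro n m
      have hDm' : MemLp (weilDilate (η n) (G (φ m))) 2 :=
        ((hGt (φ m)).1.weilDilate (hηm1 n)).memLp_two
      have hHm : MemLp (H n) 2 := (hHt n).memLp_two
      -- `H n − w = (H n − D) + (D − w)` with `D = (G (φ m))_η`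
      have s1 := integral_norm_sq_add_le (hHm.sub hDm') (hDm'.sub hw)
      have e1 : (fun x ↦ ‖(H n - weilDilate (η n) (G (φ m))) x + (weilDilate (η n) (G (φ m)) - w) x‖ ^ 2)
          = fun x ↦ ‖H n x - w x‖ ^ 2 := by
        funext x; simp only [Pi.sub_apply, sub_add_sub_cancel]
      rw [e1] at s1
      -- `∫|H n − D|² = ∫|G (φ n) − G (φ m)|²` (unitarity)
      have e2 : ∫ x, ‖(H n - weilDilate (η n) (G (φ m))) x‖ ^ 2 =
          ∫ x, ‖G (φ n) x - G (φ m) x‖ ^ 2 := by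
        have : (H n - weilDilate (η n) (G (φ m))) =
            weilDilate (η n) (fun t ↦ G (φ n) t - G (φ m) t) := by
          rw [weilDilate_sub]; rfl
        rw [this, integral_norm_sq_weilDilate _ (hηm1 n)]
      rw [e2] at s1
      -- `∫|G n − G m|² ≤ 2∫|G n − w|² + 2∫|G m − w|²`
      have s2 := integral_norm_sq_add_le ((hGm (φ n)).sub hw) ((hGm (φ m)).sub hw).neg
      have e3 : (fun x ↦ ‖(G (φ n) - w) x + (-(G (φ m) - w)) x‖ ^ 2) =
          fun x ↦ ‖G (φ n) x - G (φ m) x‖ ^ 2 := by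
        funext x; simp only [Pi.sub_apply, Pi.neg_apply]; ring_nf
      have e4 : ∫ x, ‖(-(G (φ m) - w)) x‖ ^ 2 = ∫ x, ‖G (φ m) x - w x‖ ^ 2 :=
        integral_congr_ae (Eventually.of_forall fun x ↦ by simp only [Pi.neg_apply, Pi.sub_apply, norm_neg])
      rw [e3, e4] at s2
      -- `∫|D − w|² ≤ 2∫|D − G m|² + 2∫|G m − w|²`
      have s3 := integral_norm_sq_add_le (hDm'.sub (hGm (φ m))) ((hGm (φ m)).sub hw)
      have e5 : (fun x ↦ ‖(weilDilate (η n) (G (φ m)) - G (φ m)) x + (G (φ m) - w) x‖ ^ 2) =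
          fun x ↦ ‖(weilDilate (η n) (G (φ m)) - w) x‖ ^ 2 := by
        funext x; simp only [Pi.sub_apply, sub_add_sub_cancel]
      rw [e5] at s3
      simp only [Pi.sub_apply] at s1 s2 s3 ⊢
      linarith
    rw [Metric.tendsto_atTop]
    intro ε hε
    obtain ⟨m, hm⟩ : ∃ m, ∫ t, ‖G (φ m) t - w t‖ ^ 2 < ε / 24 :=
      ((Metric.tendsto_atTop.1 hconv) (ε / 24) (by positivity)).imp fun m h ↦ by
        have := h m le_rfl
        rw [Real.dist_eq, sub_zero, abs_of_nonneg (integral_nonneg fun _ ↦ by positivity)] at this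
        exact this
    have hDil := tendsto_integral_norm_sq_weilDilate_sub (hGt (φ m)).1 hη0 hη1 hηlim
    obtain ⟨N₁, hN₁⟩ := (Metric.tendsto_atTop.1 hconv) (ε / 12) (by positivity)
    obtain ⟨N₂, hN₂⟩ := (Metric.tendsto_atTop.1 hDil) (ε / 12) (by positivity)
    refine ⟨max N₁ N₂, fun n hn ↦ ?_⟩
    have h1 := hN₁ n (le_of_max_le_left hn)
    have h2 := hN₂ n (le_of_max_le_right hn)
    rw [Real.dist_eq, sub_zero, abs_of_nonneg (integral_nonneg fun _ ↦ by positivity)] at h1 h2 ⊢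
    linarith [hbnd n m]
  -- (6) assemble
  exact ⟨w, IsWeilOddGroundState.of_tendsto hw (fun n ↦ ⟨hHt n, hHs n, hHo n, hHn n⟩) hQH hHL, hwsign⟩

/-- **Closedness, set form**: the closure (within `(0, ∞)`) of the set of good windows consists of
good windows. [folklore] -/
theorem goodWindow_of_mem_closure {a₀ : ℝ} (ha₀ : 0 < a₀)
    (h : a₀ ∈ closure {a : ℝ | ∃ u : ℝ → ℂ, IsWeilOddGroundState a u ∧
      ∀ᵐ t : ℝ, t ∈ Ioo 0 a → (u t).im = 0 ∧ 0 ≤ (u t).re}) :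
    ∃ u : ℝ → ℂ, IsWeilOddGroundState a₀ u ∧
      ∀ᵐ t : ℝ, t ∈ Ioo 0 a₀ → (u t).im = 0 ∧ 0 ≤ (u t).re := by
  obtain ⟨b, hbmem, hb⟩ := mem_closure_iff_seq_limit.1 h
  exact goodWindows_seqClosed a₀ b ha₀ hb hbmem

end Summit.RiemannHypothesis.RiemannHypothesis.Theorems.OddSector

end
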